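import Summits.CriticalPhenomena.CardyFormulaZ2.Theses.CardyRotToConf
import Literature.Probability.RandomPlanarGeometry.ChordalCurveFamilyProofs
import Literature.Probability.RandomPlanarGeometry.BrownianLoopMarkedDecomposition
import HarnessLib

/-!
# Stopping and restarting a concatenation at a closed set: exact identities
# (one-shot surgery for crux `CardyRotToConfR2SymmetryUpgrade`, stmt-CriticalPhenomena-0698)

Hitting parameters of `concatCM a b` and the exact (parametrised) identities for `stopAt`/`startFrom` of a
concatenation; `startFrom_concat_singleton` (a measurable left inverse of prefixing).
Negative lane: no Theses statement is asserted; overview in `Negative/OneShotSurgery.lean`.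
-/

noncomputable section

open Set Filter Topology Metric
open scoped unitInterval
open Literature.Probability.RandomPlanarGeometry
open Literature.Probability.RandomPlanarGeometry.BrownianLoop

namespace Summit.CriticalPhenomena.CardyFormulaZ2.Theorems.CardyRotToConfR2SymmetryUpgrade.Negative

/-! ### Hitting parameters of a concatenation -/

section Hit

variable {a b : C(I, ℂ)} {F : Set ℂ}

/-- Elements of the hit set bound the hitting parameter from above. -/
theorem hitParam_le_of_mem_hitSet {γ : Curve ℂ} {t : ℝ} (ht : t ∈ γ.hitSet F) :
    γ.hitParam F ≤ t :=
  csInf_le ⟨0, fun _ hs => (γ.hitSet_subset_Icc F hs).1⟩ ht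

/-- The midpoint parameter as an element of `[0,1]` for `sg ∈ [0,1]`: `sg/2`. -/
theorem half_mem_I (sg : I) : (sg : ℝ) / 2 ∈ I := ⟨by linarith [sg.2.1], by linarith [sg.2.2]⟩

/-- **First piece hit.** If the first piece meets `F` at its hitting parameter `sg`, the
concatenation first meets `F` at `sg / 2`. [folklore] -/
theorem hitParam_concat_of_hit (hab : a 1 = b 0) {sg : I} (hsg : (Curve.mk a).hitParam F = sg)
    (hmem : a sg ∈ F) : (Curve.mk (concatCM a b)).hitParam F = sg / 2 := by
  refine le_antisymm ?_ ?_
  · -- `sg/2` is a hit parameter of the concatenation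
    refine hitParam_le_of_mem_hitSet (Or.inl ⟨half_mem_I sg, ?_⟩)
    show concatCM a b ⟨(sg : ℝ) / 2, half_mem_I sg⟩ ∈ F
    have hle : ((⟨(sg : ℝ) / 2, half_mem_I sg⟩ : I) : ℝ) ≤ 1 / 2 := by
      show (sg : ℝ) / 2 ≤ 1 / 2; linarith [sg.2.2]
    rw [concatCM_apply_of_eq hab, if_pos hle]
    have : dbl₁ ⟨(sg : ℝ) / 2, half_mem_I sg⟩ = sg := Subtype.ext (by rw [coe_dbl₁ hle]; simp only; ring)
    rwa [this]
  · refine le_csInf ⟨1, Curve.one_mem_hitSet _ _⟩ ?_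
    rintro r (⟨hr, hmemr⟩ | hr1)
    · change concatCM a b ⟨r, hr⟩ ∈ F at hmemr
      by_cases hle : r ≤ 1 / 2
      · rw [concatCM_apply_of_eq hab, if_pos (show ((⟨r, hr⟩ : I) : ℝ) ≤ 1 / 2 from hle)] at hmemr
        have h1 : (Curve.mk a).hitParam F ≤ dbl₁ ⟨r, hr⟩ := Curve.hitParam_le hmemr
        rw [hsg, show ((dbl₁ ⟨r, hr⟩ : I) : ℝ) = 2 * r from coe_dbl₁ hle] at h1
        linarith
      · rw [not_le] at hle
        linarith [sg.2.2]
    · rw [mem_singleton_iff.1 hr1]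
      linarith [sg.2.2]

/-- **First piece misses.** If the first piece avoids `F`, the concatenation first meets `F` at
`(1 + T_b) / 2`. [folklore] -/
theorem hitParam_concat_of_forall_notMem (hab : a 1 = b 0) (hFa : ∀ t, a t ∉ F) :
    (Curve.mk (concatCM a b)).hitParam F = (1 + (Curve.mk b).hitParam F) / 2 := by
  set Tb := (Curve.mk b).hitParam F with hTb
  have hTb_mem := (Curve.mk b).hitParam_mem_Icc F
  refine le_antisymm ?_ ?_
  · -- every hit parameter `t` of `b` gives the hit parameter `(1+t)/2` of the concatenation
    refine le_of_forall_pos_lt_add fun ε hε => ?_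
    obtain ⟨t, ht, htlt⟩ := exists_lt_of_csInf_lt ⟨1, Curve.one_mem_hitSet _ _⟩
      (show (Curve.mk b).hitParam F < Tb + 2 * ε by linarith)
    have htI : t ∈ Icc (0 : ℝ) 1 := (Curve.mk b).hitSet_subset_Icc F ht
    have hmid : (1 + t) / 2 ∈ I := ⟨by linarith [htI.1], by linarith [htI.2]⟩
    have hmem : (1 + t) / 2 ∈ (Curve.mk (concatCM a b)).hitSet F := by
      rcases ht with ⟨htI', hbt⟩ | ht1
      · left
        refine ⟨hmid, ?_⟩
        show concatCM a b ⟨(1 + t) / 2, hmid⟩ ∈ F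
        rcases eq_or_lt_of_le htI'.1 with h0 | hpos
        · -- `t = 0`: the junction, `w (1/2) = a 1 = b 0`
          subst h0
          have hle : ((⟨(1 + 0) / 2, hmid⟩ : I) : ℝ) ≤ 1 / 2 := by show (1 + 0 : ℝ) / 2 ≤ 1 / 2; norm_num
          rw [concatCM_apply_of_eq hab, if_pos hle]
          have : dbl₁ ⟨(1 + 0) / 2, hmid⟩ = 1 := Subtype.ext (by rw [coe_dbl₁ hle]; norm_num)
          rw [this, hab]
          have e0 : (⟨0, htI'⟩ : I) = 0 := Subtype.ext rfl
          rw [e0] at hbt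
          exact hbt
        · have hgt : ¬ ((⟨(1 + t) / 2, hmid⟩ : I) : ℝ) ≤ 1 / 2 := by
            show ¬ (1 + t) / 2 ≤ 1 / 2
            exact not_le.2 (by linarith)
          rw [concatCM_apply_of_eq hab, if_neg hgt]
          have : dbl₂ ⟨(1 + t) / 2, hmid⟩ = ⟨t, htI'⟩ :=
            Subtype.ext (by rw [coe_dbl₂ (not_le.1 hgt).le]; simp only; ring)
          rwa [this]
      · rw [mem_singleton_iff.1 ht1]
        norm_num
        exact Curve.one_mem_hitSet _ _
    calc (Curve.mk (concatCM a b)).hitParam F ≤ (1 + t) / 2 := hitParam_le_of_mem_hitSet hmem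
      _ < (1 + Tb) / 2 + ε := by linarith
  · refine le_csInf ⟨1, Curve.one_mem_hitSet _ _⟩ ?_
    rintro r (⟨hr, hmemr⟩ | hr1)
    · change concatCM a b ⟨r, hr⟩ ∈ F at hmemr
      by_cases hle : r ≤ 1 / 2
      · rw [concatCM_apply_of_eq hab, if_pos (show ((⟨r, hr⟩ : I) : ℝ) ≤ 1 / 2 from hle)] at hmemr
        exact absurd hmemr (hFa _)
      · rw [concatCM_apply_of_eq hab, if_neg (show ¬ ((⟨r, hr⟩ : I) : ℝ) ≤ 1 / 2 from hle)] at hmemr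
        have h1 : Tb ≤ dbl₂ ⟨r, hr⟩ := Curve.hitParam_le hmemr
        rw [show ((dbl₂ ⟨r, hr⟩ : I) : ℝ) = 2 * r - 1 from coe_dbl₂ (not_le.1 hle).le] at h1
        linarith
    · rw [mem_singleton_iff.1 hr1]
      linarith [hTb_mem.2]

end Hit

/-! ### Exact identities of parametrised curves -/

section Exact

variable {a b : C(I, ℂ)} {F F' : Set ℂ}

/-- The restarted curve depends on `F` only through the hitting parameter. [folklore] -/
theorem startFrom_eq_of_hitParam_eq {γ : Curve ℂ} (h : γ.hitParam F = γ.hitParam F') :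
    γ.startFrom F = γ.startFrom F' := by
  refine Curve.ext (ContinuousMap.ext fun s => ?_)
  show γ.startFrom F s = γ.startFrom F' s
  rw [Curve.startFrom_apply, Curve.startFrom_apply, h]

/-- The stopped curve depends on `F` only through the hitting parameter. [folklore] -/
theorem stopAt_eq_of_hitParam_eq {γ : Curve ℂ} (h : γ.hitParam F = γ.hitParam F') :
    γ.stopAt F = γ.stopAt F' := by
  refine Curve.ext (ContinuousMap.ext fun s => ?_)
  show γ.stopAt F s = γ.stopAt F' s
  rw [Curve.stopAt_apply, Curve.stopAt_apply, h]

/-- **Stopped during the first piece**: if `a` meets `F` (first at `sg`), the concatenation stopped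
at `F` IS the first piece stopped at `F`, as parametrised curves. [folklore] -/
theorem stopAt_concat_of_hit (hab : a 1 = b 0) {sg : I} (hsg : (Curve.mk a).hitParam F = sg)
    (hmem : a sg ∈ F) : (Curve.mk (concatCM a b)).stopAt F = (Curve.mk a).stopAt F := by
  have hT := hitParam_concat_of_hit hab hsg hmem
  refine Curve.ext (ContinuousMap.ext fun s => ?_)
  show (Curve.mk (concatCM a b)).stopAt F s = (Curve.mk a).stopAt F s
  rw [Curve.stopAt_apply, Curve.stopAt_apply, hT, hsg]
  -- both parameters lie in `[0,1]`
  have hs1 : (sg : ℝ) / 2 * s ∈ Icc (0 : ℝ) 1 :=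
    ⟨mul_nonneg (half_mem_I sg).1 s.2.1, by nlinarith [sg.2.2, s.2.1, s.2.2, sg.2.1]⟩
  have hs2 : (sg : ℝ) * s ∈ Icc (0 : ℝ) 1 :=
    ⟨mul_nonneg sg.2.1 s.2.1, mul_le_one₀ sg.2.2 s.2.1 s.2.2⟩
  rw [projIcc_of_mem _ hs1, projIcc_of_mem _ hs2]
  show concatCM a b ⟨(sg : ℝ) / 2 * s, hs1⟩ = a ⟨(sg : ℝ) * s, hs2⟩
  have hle : ((⟨(sg : ℝ) / 2 * s, hs1⟩ : I) : ℝ) ≤ 1 / 2 := by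
    show (sg : ℝ) / 2 * s ≤ 1 / 2; nlinarith [sg.2.2, s.2.2, sg.2.1, s.2.1]
  rw [concatCM_apply_of_eq hab, if_pos hle]
  congr 1
  exact Subtype.ext (by rw [coe_dbl₁ hle]; simp only; ring)

/-- **Restarted during the second piece**: if `a` avoids `F`, the concatenation restarted at `F` IS
the second piece restarted at `F`, as parametrised curves. [folklore] -/
theorem startFrom_concat_of_forall_notMem (hab : a 1 = b 0) (hFa : ∀ t, a t ∉ F) :
    (Curve.mk (concatCM a b)).startFrom F = (Curve.mk b).startFrom F := by
  have hT := hitParam_concat_of_forall_notMem hab hFa (b := b)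
  set Tb := (Curve.mk b).hitParam F with hTb
  have hTb_mem := (Curve.mk b).hitParam_mem_Icc F
  refine Curve.ext (ContinuousMap.ext fun s => ?_)
  show (Curve.mk (concatCM a b)).startFrom F s = (Curve.mk b).startFrom F s
  rw [Curve.startFrom_apply, Curve.startFrom_apply, hT]
  have hs1 : (1 + Tb) / 2 + (1 - (1 + Tb) / 2) * s ∈ Icc (0 : ℝ) 1 :=
    ⟨by nlinarith [hTb_mem.1, s.2.1, hTb_mem.2], by nlinarith [hTb_mem.1, hTb_mem.2, s.2.1, s.2.2]⟩
  have hs2 : Tb + (1 - Tb) * s ∈ Icc (0 : ℝ) 1 :=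
    ⟨by nlinarith [hTb_mem.1, s.2.1, hTb_mem.2], by nlinarith [hTb_mem.1, hTb_mem.2, s.2.1, s.2.2]⟩
  rw [projIcc_of_mem _ hs1, projIcc_of_mem _ hs2]
  show concatCM a b ⟨_, hs1⟩ = b ⟨_, hs2⟩
  have hge : 1 / 2 ≤ ((⟨(1 + Tb) / 2 + (1 - (1 + Tb) / 2) * s, hs1⟩ : I) : ℝ) := by
    show 1 / 2 ≤ (1 + Tb) / 2 + (1 - (1 + Tb) / 2) * s; nlinarith [hTb_mem.1, hTb_mem.2, s.2.1]
  rcases hge.eq_or_lt with heq | hlt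
  · -- junction case: `Tb = 0` and `s = 0`... then both sides are `b 0 = a 1`
    rw [concatCM_apply_of_eq hab, if_pos heq.symm.le]
    have h1 : dbl₁ ⟨(1 + Tb) / 2 + (1 - (1 + Tb) / 2) * s, hs1⟩ = 1 :=
      Subtype.ext (by rw [coe_dbl₁ heq.symm.le, Set.Icc.coe_one]; simp only at heq ⊢; linarith)
    rw [h1, hab]
    congr 1
    apply Subtype.ext
    simp only [Set.Icc.coe_zero] at heq ⊢
    show (0 : ℝ) = Tb + (1 - Tb) * s
    nlinarith [hTb_mem.1, hTb_mem.2, s.2.1, s.2.2]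
  · rw [concatCM_apply_of_eq hab, if_neg (not_le.2 hlt)]
    congr 1
    exact Subtype.ext (by rw [coe_dbl₂ hlt.le]; simp only; ring)

/-- **Left inverse of prefixing.** If the first piece visits its endpoint `a 1` only at the end,
restarting the concatenation at `{a 1}` gives back the second piece exactly. [folklore] -/
theorem startFrom_concat_singleton (hab : a 1 = b 0) (ha : ∀ t : I, a t = a 1 → t = 1) :
    (Curve.mk (concatCM a b)).startFrom {a 1} = Curve.mk b := by
  -- `a` meets `{a 1}` first at `sg = 1`
  have hsg : (Curve.mk a).hitParam {a 1} = (1 : I) := by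
    refine le_antisymm ((Curve.mk a).hitParam_mem_Icc _).2 (le_csInf ⟨1, Curve.one_mem_hitSet _ _⟩ ?_)
    rintro r (⟨hr, hmem⟩ | hr1)
    · have := ha ⟨r, hr⟩ hmem
      have := congrArg Subtype.val this
      simp only [Set.Icc.coe_one] at this
      exact this.ge
    · exact (mem_singleton_iff.1 hr1).ge
  have hT := hitParam_concat_of_hit hab (F := {a 1}) hsg rfl
  refine Curve.ext (ContinuousMap.ext fun s => ?_)
  show (Curve.mk (concatCM a b)).startFrom {a 1} s = b s
  rw [Curve.startFrom_apply, hT]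
  simp only [Set.Icc.coe_one]
  have hs1 : (1 : ℝ) / 2 + (1 - 1 / 2) * s ∈ Icc (0 : ℝ) 1 := ⟨by linarith [s.2.1], by linarith [s.2.2]⟩
  rw [projIcc_of_mem _ hs1]
  show concatCM a b ⟨_, hs1⟩ = b s
  have hge : 1 / 2 ≤ ((⟨(1 : ℝ) / 2 + (1 - 1 / 2) * s, hs1⟩ : I) : ℝ) := by
    show (1 : ℝ) / 2 ≤ 1 / 2 + (1 - 1 / 2) * s; linarith [s.2.1]
  rcases hge.eq_or_lt with heq | hlt
  · rw [concatCM_apply_of_eq hab, if_pos heq.symm.le]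
    have h1 : dbl₁ ⟨(1 : ℝ) / 2 + (1 - 1 / 2) * s, hs1⟩ = 1 :=
      Subtype.ext (by rw [coe_dbl₁ heq.symm.le, Set.Icc.coe_one]; simp only at heq ⊢; linarith)
    rw [h1, hab]
    congr 1
    apply Subtype.ext
    simp only [Set.Icc.coe_zero] at heq ⊢
    linarith
  · rw [concatCM_apply_of_eq hab, if_neg (not_le.2 hlt)]
    congr 1
    exact Subtype.ext (by rw [coe_dbl₂ hlt.le]; simp only; ring)

end Exact

end Summit.CriticalPhenomena.CardyFormulaZ2.Theorems.CardyRotToConfR2SymmetryUpgrade.Negative
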